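import Summits.QuantumFields.YangMills.Theorems.BalabanUVNodesN12DirectSurjHsurjPrelim
import Summits.QuantumFields.YangMills.Theorems.BalabanUVNodesN12DirectSurjTriangular
import Summits.QuantumFields.YangMills.Theorems.BalabanUVNodesN12DirectSurjSiteBlockFlat
import Summits.QuantumFields.YangMills.Theorems.BalabanUVNodesN12DirectSurjSiteBlockCurved
import Summits.QuantumFields.YangMills.Theorems.BalabanUVNodesN12DirectSurjFootprint
import Literature.MathematicalPhysics.QuantumFieldTheory.Balaban1983to89.B16Ineq19NearFlatSliceNorms
import Literature.MathematicalPhysics.QuantumFieldTheory.Balaban1983to89.Node00.MultiScaleFibreChartLocalityComponent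

/-!
# DAG node N12 [B15] — (P4)′ road, THE ASSEMBLY: a right inverse `H` of `DΨ_{𝐁_k(Z),W,U₀}(0)` with a letter `B` chosen BEFORE `W, U₀`, at every guarded
# fibre point `U₀` whose plaquettes are small on the `3^d`-block boxes around the inner sites — by block-triangular back-substitution

Cell `pub-ymgap` (HUMAN RULINGS D-0062 ∕ D-0149), width seat `pub-ymgap-dag-n12-w6` g6 = the N12 (P4) clone by row (director-ym R463-ym).  Key K1⁹ `stmt-QuantumFields-27364`,
`--kind proof --supports … --as helper`; count-neutral; THEOREMS ONLY (0 `def`, 0 `sorry`).  Design note `HOME/pub-ymgap-dag-n12-w6/P4-DESIGN.md`.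

TARGET (dag-n12-c g20's (P4)′ SOCKET OF RECORD, INBOX l.42120 (2)): `∃ H, (∀ v, DΨ(0)(H v) = v) ∧ (∀ v, √(Σ_b ‖H v b‖²) ≤ B·‖v‖)` at every guarded fibre point, ONE `B ≥ 0`
chosen BEFORE `V_k ∕ U₀`.  (The literal (P4) of p654775, with the support clause, is unsatisfiable — dag-n08-c's p657858; the support clause is not part of the socket.)

THE THEOREM (★★★ `exists_rightInverse_letter`).  For `k + 1 ≤ m + K` there is ONE `ε > 0` (depending on the family, `K`, `k`, `N` only) such that for every `M₁ ≥ 1`, `Z` with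
[III] (2.13)'s divisibility, there is `B ≥ 0` such that: for every multi-scale datum `W` and every `U₀` in the fibre `AgreeOn (𝐁_k(Z)) (M˙U₀) W` with the guard
`SmallBelow … k U₀` whose plaquette holonomies are `< ε` on the box `[ι_j y − (L^j + (L^j−1)∕2), ι_j y + (L^j + (L^j−1)∕2)]^d` around every INNER `j`-site `y`
(`ι_j y ∈ Ω_j(Z)`, `1 ≤ j ≤ k`), the chart derivative `DΨ_{𝐁_k(Z),W,U₀}(0)` has a right inverse `H` with `√(Σ_b ‖H v b‖²) ≤ B‖v‖`.

PROOF (Bałaban [15] (83) p.290 with (44)–(47) p.285 and [III] (2.2)∕(2.13), organised as a block-triangular back-substitution instead of print's global Neumann series):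
rank the constrained rows — level-0 rows rank `0` (there `DΨ(0)` IS the evaluation, `Node00.fderiv_msChart_apply_levelZero`, so the column is the identity placement);
a level-`j` row (`j ≥ 1`) has an inner end-point (`Γ_j ⊆ ι_j⁻¹ Ω_j`) and is ranked `1 + j·S + φ_j(host)` by its inner HOST site (the inner end-point with the larger
label).  RANK-WISE SOLVABILITY: the rows hosted at an inner `j`-site `y` are hit exactly by a direction supported on the fine bonds crossing the internal `(j−1)`-faces of
`B^j(y)` (`…SiteBlockFlat.exists_flat_siteBlock` twisted by ONE axial box gauge `…BoxGauge.exists_boxGauge` and corrected by the `q = ½` Neumann series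
`…SiteBlockCurved.exists_curved_siteBlock`), and such a direction is invisible to every row of level `≤ j−1` and to every level-`j` row not touching `y`
(`…Footprint.fderiv_msChart_apply_eq_zero_of_siteSupport`: iterated two-block locality + (2.13) geometry) — i.e. to every row of smaller rank.  UNIFORM ROW BOUND
`Λ` (`…SiteBlockCurved.exists_rowBound` with the box gauge at the row's host).  Then p660274's `…Triangular.exists_rightInverse_bound_of_rankwise` gives `H` with the
explicit letter `β·N·(1+Λβ)^N`, and `√Σ ≤ √#bonds · sup` converts the norm.

CONTENTS.  ★★★ `exists_rightInverse_letter` (small lemmas in `…N12DirectSurjHsurjPrelim`; the `Z`-wide plaquette-letter edition in `…N12DirectSurjHsurjZ`).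

HONEST FRAMING.  Bookkeeping by name over the five landed pieces; the constants are per-height ∕ per-instance EXISTENCE constants (print's (46)∕(83) are explicit and
volume-uniform — NOT claimed); the plaquette letter on the boxes is a HYPOTHESIS at `U₀` (its `Z`-wide edition: `…HsurjZ`); nothing of Bałaban's asserted; N12 NOT discharged; K1⁹ NOT closed; count-neutral (typed 28∕28 · discharged 5∕27 unmoved); R4 closes only the
conditional finite-`𝕋⁴` rung `BalabanLadder.UV`; the YM mass gap (Clay) is NOT proved by any of this.
-/

noncomputable section

open scoped BigOperators Matrix.Norms.L2Operator Topology NNReal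
open Filter

namespace Summit.QuantumFields.YangMills.BalabanUVNodes.N12DirectSurjHsurj

open Literature.MathematicalPhysics.QuantumFieldTheory.Balaban1983to89
open T4Continuum (T4Family)
open BlockAveragingEMLLinearised (linAvg)
open T4AdjointCovarianceUnitary (lieSU)
open B15DeterminingSets
open B14.Eq213DetSet (Bj maxDomT Bj_of_gt)
open B14.Eq213MaximalDomains (side)
open B5Eq118OneStroke (iterBlockOf)
open B15Eq112TorusCover (lift)
open T4AxialGaugeSmallField (boxPlaqs)
open B16Ineq19NearFlatSliceNorms (opNorm_coe_le_norm_lieSU)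
open Node00
open Summit.QuantumFields.YangMills.BalabanUVNodes.N12DirectSurjTriangular (exists_rightInverse_bound_of_rankwise)
open Summit.QuantumFields.YangMills.BalabanUVNodes.N12DirectSurjSiteBlockFlat (exists_flat_siteBlock)
open Summit.QuantumFields.YangMills.BalabanUVNodes.N12DirectSurjSiteBlockCurved (exists_rowBound exists_curved_siteBlock)
open Summit.QuantumFields.YangMills.BalabanUVNodes.N12DirectSurjFootprint (fderiv_msChart_apply_eq_zero_of_siteSupport)
open Summit.QuantumFields.YangMills.BalabanUVNodes.N12DirectSurjBoxGauge (exists_boxGauge)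
open Summit.QuantumFields.YangMills.BalabanUVNodes.N12DirectSurjHsurjPrelim

/-! ## The assembly -/

section Record

variable {F : T4Family} {N : ℕ} [NeZero N] {K k : ℕ}

set_option maxHeartbeats 400000 in
/-- ★★★ **(P4)′ — A RIGHT INVERSE OF THE CHART DERIVATIVE WITH A LETTER CHOSEN BEFORE THE FIBRE POINT.**  For `k + 1 ≤ m + K` there is `ε > 0` such that for all `M₁ ≥ 1` and
`Z` (with (2.13)'s divisibility) there is `B ≥ 0` with: for every datum `W` and every `U₀` in the fibre `AgreeOn (𝐁_k(Z)) (M˙U₀) W` with the guard `SmallBelow … k U₀`, whose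
plaquette holonomies are `< ε` on the box of half-width `L^j + (L^j−1)∕2` around `ι_j y` for every inner `j`-site `y` (`1 ≤ j ≤ k`), there is `H` with `DΨ_{𝐁_k(Z),W,U₀}(0) ∘ H = id`
and `√(Σ_b ‖H v b‖²) ≤ B‖v‖`.  (For the record instance of p654775: `N = 2`, `W = M˙(Q̄*G)^k(ext V_k)`, `hU := hmin0.2.1`, `hsb` as there; the box letter follows from the
small-plaquette condition on `Z` since the boxes lie in `Ω_{j−1}(Z) ⊆ Z` for `M₁ ≥ 2`.)  Block-triangular back-substitution over the five landed pieces; per-instance EXISTENCE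
constants, not print's volume-uniform ones.  (`maxHeartbeats`: cumulative unification of one long bookkeeping proof only.) [cite: Balaban1985Variational, (83) p.290, (44)-(47)
p.285, (153) p.301; Balaban1988Convergent, (2.2) p.255, (2.11)-(2.13) pp.256-257] -/
theorem exists_rightInverse_letter (hkK : k + 1 ≤ (F.P K).m + (F.P K).K) :
    ∃ ε : ℝ, 0 < ε ∧ ∀ (M₁ : ℕ) (_ : 1 ≤ M₁) (Z : Set (Site (F.P K) 0)) (_ : side (F.P K).L M₁ k ∣ (F.P K).sitesPerDir 0),
      ∃ B : ℝ, 0 ≤ B ∧ ∀ (W : MSField (F.P K) (SU N)) (U₀ : GaugeField (F.P K) 0 (SU N)),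
        AgreeOn (Bj M₁ Z k) (avgFamily (avOfRecord F N K) U₀) W → SmallBelow (avOfRecord F N K) k U₀ →
        (∀ (j : ℕ), 1 ≤ j → j ≤ k → ∀ y : Site (F.P K) j, embIter j y ∈ maxDomT M₁ Z j →
          PlaqSmallOn (boxPlaqs (P := F.P K) (j := 0)
            (fun κ => lift (F.P K) (embIter j y) κ - ((((F.P K).L ^ j : ℕ) : ℤ) + ((((F.P K).L ^ j - 1) / 2 : ℕ) : ℤ)))
            (fun κ => lift (F.P K) (embIter j y) κ + ((((F.P K).L ^ j : ℕ) : ℤ) + ((((F.P K).L ^ j - 1) / 2 : ℕ) : ℤ)))) ε U₀) →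
        ∃ H : (Fin (constrCard (Bj M₁ Z k) k) → lieSU (Fin N)) → PBond (F.P K) 0 → lieSU (Fin N),
          (∀ v, fderiv ℝ (msChart F N K k (Bj M₁ Z k) W U₀) 0 (H v) = v) ∧
          ∀ v, Real.sqrt (∑ b, ‖H v b‖ ^ 2) ≤ B * ‖v‖ := by
  classical
  have hk : k ≤ (F.P K).m + (F.P K).K := Nat.le_of_succ_le hkK
  -- (0) the linearised-averaging recursion family and the seminorm `p = #bonds · sup`
  obtain ⟨Q, hQ0, hQs⟩ : ∃ Q : (i : ℕ) → (PBond (F.P K) 0 → Matrix (Fin N) (Fin N) ℂ) → PBond (F.P K) i → Matrix (Fin N) (Fin N) ℂ,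
      (∀ Y, Q 0 Y = Y) ∧ ∀ (i : ℕ) (Y : PBond (F.P K) 0 → Matrix (Fin N) (Fin N) ℂ) (c : PBond (F.P K) (i + 1)), Q (i + 1) Y c = linAvg (Q i Y) c :=
    ⟨fun i => Nat.rec (motive := fun i => (PBond (F.P K) 0 → Matrix (Fin N) (Fin N) ℂ) → PBond (F.P K) i → Matrix (Fin N) (Fin N) ℂ) (fun Y => Y)
      (fun _ Qi Y c => linAvg (Qi Y) c) i, fun _ => rfl, fun _ _ _ => rfl⟩
  set Cp : ℝ := (Fintype.card (PBond (F.P K) 0) : ℝ) with hCp_def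
  have hCp : 0 ≤ Cp := Nat.cast_nonneg _
  let p : Seminorm ℝ (PBond (F.P K) 0 → lieSU (Fin N)) := (Fintype.card (PBond (F.P K) 0) : ℝ≥0) • normSeminorm ℝ (PBond (F.P K) 0 → lieSU (Fin N))
  have hpY : ∀ Y, p Y = Cp * ‖Y‖ := fun Y => by
    show ((Fintype.card (PBond (F.P K) 0) : ℝ≥0) • normSeminorm ℝ (PBond (F.P K) 0 → lieSU (Fin N))) Y = _
    rw [hCp_def]; simp [NNReal.smul_def]
  have hp : ∀ Y : PBond (F.P K) 0 → lieSU (Fin N), ∑ b, ‖(Y b : Matrix (Fin N) (Fin N) ℂ)‖ ^ 2 ≤ p Y ^ 2 := fun Y => by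
    have h1 : ∀ b, ‖(Y b : Matrix (Fin N) (Fin N) ℂ)‖ ^ 2 ≤ ‖Y‖ ^ 2 := fun b =>
      pow_le_pow_left₀ (norm_nonneg _) ((opNorm_coe_le_norm_lieSU (Y b)).trans (norm_le_pi_norm Y b)) 2
    have hc : Cp ≤ Cp ^ 2 := by
      rcases Nat.eq_zero_or_pos (Fintype.card (PBond (F.P K) 0)) with h | h
      · simp [hCp_def, h]
      · have : (1 : ℝ) ≤ Cp := by rw [hCp_def]; exact_mod_cast h
        nlinarith
    calc ∑ b, ‖(Y b : Matrix (Fin N) (Fin N) ℂ)‖ ^ 2 ≤ ∑ _b : PBond (F.P K) 0, ‖Y‖ ^ 2 := Finset.sum_le_sum fun b _ => h1 b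
      _ = Cp * ‖Y‖ ^ 2 := by rw [Finset.sum_const, Finset.card_univ, nsmul_eq_mul]
      _ ≤ Cp ^ 2 * ‖Y‖ ^ 2 := mul_le_mul_of_nonneg_right hc (sq_nonneg _)
      _ = p Y ^ 2 := by rw [hpY, mul_pow]
  have hpn : ∀ Y, p Y ≤ Cp * ‖Y‖ := fun Y => (hpY Y).le
  -- (1) the two per-height constants: the row bound and the curved site block
  obtain ⟨C₁, ρ₁, hC₁, hρ₁, hRB⟩ := exists_rowBound (F := F) (N := N) (K := K) k Q hQ0 hQs p hp hCp hpn
  obtain ⟨C₂, ρ₂, hC₂, hρ₂, hblk⟩ := exists_curved_siteBlock (F := F) (N := N) (K := K) k Q hQ0 hQs p hp hCp hpn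
  -- (2) flat site blocks at every `(n+1)`-site, with a uniform letter `CΦ`
  have hfl : ∀ (n : ℕ) (y : Site (F.P K) (n + 1)), ∃ (Φ : (PBond (F.P K) (n + 1) → lieSU (Fin N)) →ₗ[ℝ] (PBond (F.P K) 0 → lieSU (Fin N))) (C : ℝ),
      0 ≤ C ∧ (∀ v, ‖Φ v‖ ≤ C * ‖v‖) ∧ (n + 1 ≤ (F.P K).m + (F.P K).K →
        (∀ (v : PBond (F.P K) (n + 1) → lieSU (Fin N)) (c : PBond (F.P K) (n + 1)), (c.src = y ∨ c.tgt = y) →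
            Q (n + 1) (fun b => (Φ v b : Matrix (Fin N) (Fin N) ℂ)) c = (v c : Matrix (Fin N) (Fin N) ℂ)) ∧
        (∀ v (b : PBond (F.P K) 0), Φ v b ≠ 0 → iterBlockOf (n + 1) b.src = y ∧ iterBlockOf (n + 1) b.tgt = y ∧ iterBlockOf n b.src ≠ iterBlockOf n b.tgt)) := by
    intro n y
    by_cases h : n + 1 ≤ (F.P K).m + (F.P K).K
    · obtain ⟨Φ, hQ, hsupp, C, hC, hCn⟩ := exists_flat_siteBlock (N := N) h y
      exact ⟨Φ, C, hC, hCn, fun _ => ⟨fun v c hc => hQ Q hQ0 hQs v c hc, hsupp⟩⟩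
    · exact ⟨0, 0, le_rfl, fun v => by simp, fun h' => absurd h' h⟩
  choose Φf CΦf hCΦf0 hCΦfn hΦprops using hfl
  set CΦ : ℝ := 1 + ∑ σ : (i : Fin k) × Site (F.P K) ((i : ℕ) + 1), CΦf σ.1 σ.2 with hCΦ_def
  have hCΦsum : 0 ≤ ∑ σ : (i : Fin k) × Site (F.P K) ((i : ℕ) + 1), CΦf σ.1 σ.2 := Finset.sum_nonneg fun σ _ => hCΦf0 _ _
  have hCΦ1 : 1 ≤ CΦ := by rw [hCΦ_def]; linarith
  have hCΦ0 : 0 ≤ CΦ := zero_le_one.trans hCΦ1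
  have hCΦle : ∀ (n : ℕ) (hn : n < k) (y : Site (F.P K) (n + 1)), CΦf n y ≤ CΦ := fun n hn y => by
    have h := Finset.single_le_sum (f := fun σ : (i : Fin k) × Site (F.P K) ((i : ℕ) + 1) => CΦf σ.1 σ.2) (fun σ _ => hCΦf0 _ _)
      (Finset.mem_univ (⟨⟨n, hn⟩, y⟩ : (i : Fin k) × Site (F.P K) ((i : ℕ) + 1)))
    rw [hCΦ_def]
    exact le_trans h (by linarith)
  -- (3) the near-flatness scale `D·ε` of the box gauges and the threshold `ε`
  set D : ℝ := (((F.P K).d - 1 : ℕ) : ℝ) * ((2 * ((F.P K).L ^ k + ((F.P K).L ^ k - 1) / 2) : ℕ) : ℝ) with hD_def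
  have hD0 : 0 ≤ D := mul_nonneg (Nat.cast_nonneg _) (Nat.cast_nonneg _)
  have hDj : ∀ j ≤ k, (((F.P K).d - 1 : ℕ) : ℝ) * ((2 * ((F.P K).L ^ j + ((F.P K).L ^ j - 1) / 2) : ℕ) : ℝ) ≤ D := fun j hj => by
    rw [hD_def]
    refine mul_le_mul_of_nonneg_left ?_ (Nat.cast_nonneg _)
    have h1 : (F.P K).L ^ j ≤ (F.P K).L ^ k := Nat.pow_le_pow_right (F.P K).L_pos hj
    have h2 : ((F.P K).L ^ j - 1) / 2 ≤ ((F.P K).L ^ k - 1) / 2 := Nat.div_le_div_right (by omega)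
    exact_mod_cast (by omega : 2 * ((F.P K).L ^ j + ((F.P K).L ^ j - 1) / 2) ≤ 2 * ((F.P K).L ^ k + ((F.P K).L ^ k - 1) / 2))
  set ρ : ℝ := min ρ₁ ρ₂ with hρ_def
  have hρ : 0 < ρ := lt_min hρ₁ hρ₂
  set Pd : ℝ := 4 * (D + 1) * ((C₂ + 1) * (Cp * CΦ + 1) * (ρ + 1)) with hPd_def
  have hge1 : 1 ≤ (C₂ + 1) * (Cp * CΦ + 1) * (ρ + 1) :=
    one_le_mul_of_one_le_of_one_le (one_le_mul_of_one_le_of_one_le (by linarith) (by nlinarith)) (by linarith)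
  have hPd : 4 * (D + 1) ≤ Pd := by
    rw [hPd_def]; exact le_mul_of_one_le_right (by linarith) hge1
  have hPd0 : 0 < Pd := lt_of_lt_of_le (by linarith) hPd
  set ε : ℝ := ρ / Pd with hε_def
  have hε : 0 < ε := div_pos hρ hPd0
  -- the two smallness consequences: `D·ε < ρ` and `C₂·(D·ε)·(Cp·CΦ) ≤ 1/2`
  have hDε : D * ε < ρ := by
    rw [hε_def, ← mul_div_assoc, div_lt_iff₀ hPd0]
    nlinarith
  have hDεC : C₂ * (D * ε) * (Cp * CΦ) ≤ 1 / 2 := by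
    have h1 : C₂ * (D * ε) * (Cp * CΦ) = (C₂ * D * ρ * (Cp * CΦ)) / Pd := by rw [hε_def]; ring
    rw [h1, div_le_iff₀ hPd0, hPd_def]
    have hM0 : 0 ≤ Cp * CΦ := mul_nonneg hCp hCΦ0
    have h2 : C₂ * D * ρ * (Cp * CΦ) ≤ (C₂ + 1) * (D + 1) * (ρ + 1) * (Cp * CΦ + 1) :=
      mul_le_mul (mul_le_mul (mul_le_mul (by linarith) (by linarith) hD0 (by linarith)) (by linarith) hρ.le
        (mul_nonneg (by linarith) (by linarith))) (by linarith) hM0 (mul_nonneg (mul_nonneg (by linarith) (by linarith)) (by linarith))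
    nlinarith
  refine ⟨ε, hε, fun M₁ hM1 Z hdiv => ?_⟩
  -- (4) per instance: sizes, labels, hosts, ranks
  have h𝔹 : ∀ j, k < j → Bj M₁ Z k j = ∅ := fun j hj => Bj_of_gt hj
  set Smax : ℕ := ∑ j ∈ Finset.range (k + 1), Fintype.card (Site (F.P K) j) with hSmax_def
  have hS : ∀ j ≤ k, Fintype.card (Site (F.P K) j) ≤ Smax := fun j hj =>
    Finset.single_le_sum (f := fun j => Fintype.card (Site (F.P K) j)) (fun _ _ => Nat.zero_le _) (Finset.mem_range.2 (Nat.lt_succ_of_le hj))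
  obtain ⟨φ, hφlt, hφinj⟩ : ∃ φ : (j : ℕ) → Site (F.P K) j → ℕ, (∀ j y, φ j y < Fintype.card (Site (F.P K) j)) ∧ ∀ j, Function.Injective (φ j) :=
    ⟨fun j y => (Fintype.equivFin (Site (F.P K) j) y : ℕ), fun j y => (Fintype.equivFin _ y).isLt,
      fun j y y' h => (Fintype.equivFin _).injective (Fin.ext h)⟩
  let inner : (j : ℕ) → Site (F.P K) j → Prop := fun j y => embIter j y ∈ maxDomT M₁ Z j
  have hhost := fun j => exists_host (inner j) (φ j)
  choose hostF hostF_mem hostF_inner hostF_max using hhost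
  let host : (j : ℕ) → PBond (F.P K) j → Site (F.P K) j := fun j c => hostF j c.src c.tgt
  have host_mem : ∀ j (c : PBond (F.P K) j), host j c = c.src ∨ host j c = c.tgt := fun j c => hostF_mem j c.src c.tgt
  have host_inner : ∀ j (c : PBond (F.P K) j), (inner j c.src ∨ inner j c.tgt) → inner j (host j c) := fun j c h => hostF_inner j c.src c.tgt h
  have host_max : ∀ j (c : PBond (F.P K) j) (y : Site (F.P K) j), inner j y → (c.src = y ∨ c.tgt = y) → φ j y ≤ φ j (host j c) :=
    fun j c y hy h => hostF_max j c.src c.tgt y hy h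
  let code : (j : ℕ) → Site (F.P K) j → ℕ := fun j y => 1 + j * Smax + φ j y
  have code_def : ∀ j (y : Site (F.P K) j), code j y = 1 + j * Smax + φ j y := fun _ _ => rfl
  have code_pos : ∀ j (y : Site (F.P K) j), 0 < code j y := fun j y => by rw [code_def]; omega
  have code_lt : ∀ (j j' : ℕ) (y : Site (F.P K) j) (y' : Site (F.P K) j'), j ≤ k → j < j' → code j y < code j' y' := fun j j' y y' hj hjj' => by
    rw [code_def, code_def]
    have h1 : φ j y < Smax := lt_of_lt_of_le (hφlt j y) (hS j hj)
    have h2 : (j + 1) * Smax ≤ j' * Smax := Nat.mul_le_mul_right _ hjj'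
    have h3 : (j + 1) * Smax = j * Smax + Smax := by ring
    omega
  have code_le_of_lt : ∀ (j j' : ℕ) (y : Site (F.P K) j) (y' : Site (F.P K) j'), j' ≤ k → code j y < code j' y' → j ≤ j' :=
    fun j j' y y' hj' h => by
      by_contra hlt
      exact absurd h (not_lt.2 (code_lt j' j y' y hj' (lt_of_not_ge hlt)).le)
  have code_eq : ∀ (j j' : ℕ) (y : Site (F.P K) j) (y' : Site (F.P K) j'), j ≤ k → j' ≤ k → code j y = code j' y' → j = j' :=
    fun j j' y y' hj hj' h => by
      rcases lt_trichotomy j j' with hlt | heq | hgt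
      · exact absurd h (code_lt j j' y y' hj hlt).ne
      · exact heq
      · exact absurd h.symm (code_lt j' j y' y hj' hgt).ne
  have code_inj : ∀ (j : ℕ) (y y' : Site (F.P K) j), code j y = code j y' → y = y' := fun j y y' h =>
    hφinj j (by rw [code_def, code_def] at h; omega)
  have code_lt_iff : ∀ (j : ℕ) (y y' : Site (F.P K) j), code j y < code j y' ↔ φ j y < φ j y' := fun j y y' => by
    rw [code_def, code_def]; omega
  have code_bound : ∀ (j : ℕ) (y : Site (F.P K) j), j ≤ k → code j y < 1 + k * Smax + Smax := fun j y hj => by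
    rw [code_def]
    have h1 : φ j y < Smax := lt_of_lt_of_le (hφlt j y) (hS j hj)
    have h2 : j * Smax ≤ k * Smax := Nat.mul_le_mul_right _ hj
    omega
  let rk : ConstrSet (Bj M₁ Z k) k → ℕ := fun s => if ((s.1 : ℕ)) = 0 then 0 else code s.1 (host s.1 s.2.1)
  obtain ⟨rank, hrank⟩ : ∃ rank : Fin (constrCard (Bj M₁ Z k) k) → ℕ, ∀ s, rank (constrEnum (Bj M₁ Z k) k s) = rk s :=
    ⟨fun i => rk ((constrEnum (Bj M₁ Z k) k).symm i), fun s => congrArg rk ((constrEnum (Bj M₁ Z k) k).symm_apply_apply s)⟩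
  have hrk : ∀ (j' : ℕ) (hj' : j' < k + 1) (c' : PBond (F.P K) j') (hc' : c' ∈ bondsOf (Bj M₁ Z k j')),
      rk ⟨⟨j', hj'⟩, c', hc'⟩ = if j' = 0 then 0 else code j' (host j' c') := fun _ _ _ _ => rfl
  -- (5) the flat chart derivative's letter `Λ₀` and the row bound `Λ`
  obtain ⟨Λ₀, hΛ₀pos, hΛ₀⟩ := SemilinearMapClass.bound_of_continuous
    (fderiv ℝ (msChart F N K k (Bj M₁ Z k) (avgFamily (avOfRecord F N K) (1 : GaugeField (F.P K) 0 (SU N))) (1 : GaugeField (F.P K) 0 (SU N))) 0)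
    (ContinuousLinearMap.continuous _)
  set Λ : ℝ := Λ₀ + C₁ * ρ₁ * Cp + 1 with hΛ_def
  have hΛ1 : 1 ≤ Λ := by rw [hΛ_def]; nlinarith [mul_nonneg (mul_nonneg hC₁ hρ₁.le) hCp]
  have hΛ0 : 0 ≤ Λ := zero_le_one.trans hΛ1
  set β : ℝ := 1 + 2 * CΦ with hβ_def
  have hβ0 : 0 ≤ β := by rw [hβ_def]; linarith
  have hβ1 : 1 ≤ β := by rw [hβ_def]; linarith
  set Nr : ℕ := 1 + k * Smax + Smax with hNr_def
  refine ⟨Real.sqrt (Fintype.card (PBond (F.P K) 0)) * (β * Nr * (1 + Λ * β) ^ Nr),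
    mul_nonneg (Real.sqrt_nonneg _) (mul_nonneg (mul_nonneg hβ0 (Nat.cast_nonneg _)) (pow_nonneg (add_nonneg zero_le_one (mul_nonneg hΛ0 hβ0)) _)),
    fun W U₀ hU hsb hplaq => ?_⟩
  have hΨ : DifferentiableAt ℝ (msChart F N K k (Bj M₁ Z k) W U₀) 0 := differentiableAt_msChart hU hsb
  -- (6) the box gauge at an inner site and the induced near-flatness on the sharp towers of the rows touching it
  have hgauge : ∀ (j : ℕ), 1 ≤ j → j ≤ k → ∀ y : Site (F.P K) j, inner j y →
      ∃ u : GaugeTransf (F.P K) 0 (SU N), ∀ (c : PBond (F.P K) j), (c.src = y ∨ c.tgt = y) → ∀ b₀ : PBond (F.P K) 0,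
        (iterBlockOf j b₀.src = c.src ∨ iterBlockOf j b₀.src = c.tgt) → (iterBlockOf j b₀.tgt = c.src ∨ iterBlockOf j b₀.tgt = c.tgt) →
        ‖((GaugeField.gaugeAct u U₀ b₀ : SU N) : Matrix (Fin N) (Fin N) ℂ) - 1‖ ≤ D * ε := by
    intro j hj1 hjk y hy
    obtain ⟨u, hu⟩ := exists_boxGauge (P := F.P K) (N := N) (hjk.trans hk) (three_mul_pow_lt_sitesPerDir hkK hjk) y U₀ hε.le (hplaq j hj1 hjk y hy)
    exact ⟨u, fun c hc b₀ hs ht => (hu b₀ (near_of_endpoint c hc _ hs) (near_of_endpoint c hc _ ht)).trans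
      (mul_le_mul_of_nonneg_right (hDj j hjk) hε.le)⟩
  have hDερ₁ : D * ε < ρ₁ := hDε.trans_le (min_le_left _ _)
  have hDερ₂ : D * ε < ρ₂ := hDε.trans_le (min_le_right _ _)
  have hDε0 : 0 ≤ D * ε := mul_nonneg hD0 hε.le
  -- (7) the linear map and its uniform bound
  set L : (PBond (F.P K) 0 → lieSU (Fin N)) →ₗ[ℝ] (Fin (constrCard (Bj M₁ Z k) k) → lieSU (Fin N)) :=
    (fderiv ℝ (msChart F N K k (Bj M₁ Z k) W U₀) 0).toLinearMap with hL_def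
  have hLapp : ∀ x i, L x i = fderiv ℝ (msChart F N K k (Bj M₁ Z k) W U₀) 0 x i := fun _ _ => rfl
  have hrow : ∀ (s : ConstrSet (Bj M₁ Z k) k) (x : PBond (F.P K) 0 → lieSU (Fin N)),
      ‖fderiv ℝ (msChart F N K k (Bj M₁ Z k) W U₀) 0 x (constrEnum (Bj M₁ Z k) k s)‖ ≤ Λ * ‖x‖ := by
    rintro ⟨⟨j', hj'⟩, c', hc'⟩ x
    have hj'k : j' ≤ k := Nat.lt_succ_iff.1 hj'
    rcases Nat.eq_zero_or_pos j' with rfl | hpos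
    · rw [fderiv_msChart_apply_levelZero hU hΨ c' hc' x]
      exact (norm_le_pi_norm x c').trans (le_mul_of_one_le_left (norm_nonneg _) hΛ1)
    · have hin : inner j' (host j' c') := host_inner j' c' (inner_endpoint_of_mem_bondsOf_Bj hpos hj'k hc')
      obtain ⟨u, hu⟩ := hgauge j' hpos hj'k (host j' c') hin
      have hflat := hu c' ((host_mem j' c').elim (fun h => Or.inl h.symm) (fun h => Or.inr h.symm))
      have h := hRB (Bj M₁ Z k) h𝔹 hk W U₀ hU hsb (constrEnum (Bj M₁ Z k) k ⟨⟨j', hj'⟩, c', hc'⟩) u hDε0 hDερ₁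
      rw [Equiv.symm_apply_apply] at h
      refine (h hflat hΛ₀pos.le hΛ₀ x).trans (mul_le_mul_of_nonneg_right ?_ (norm_nonneg _))
      rw [hΛ_def]
      have : C₁ * (D * ε) * Cp ≤ C₁ * ρ₁ * Cp := mul_le_mul_of_nonneg_right (mul_le_mul_of_nonneg_left hDερ₁.le hC₁) hCp
      linarith
  have hLbound : ∀ x, ‖L x‖ ≤ Λ * ‖x‖ := fun x =>
    (pi_norm_le_iff_of_nonneg (mul_nonneg hΛ0 (norm_nonneg _))).2 fun i => by
      obtain ⟨s, rfl⟩ := (constrEnum (Bj M₁ Z k) k).surjective i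
      rw [hLapp]
      exact hrow s x
  have hNr : ∀ i, rank i < Nr := fun i => by
    obtain ⟨⟨⟨j', hj'⟩, c', hc'⟩, rfl⟩ := (constrEnum (Bj M₁ Z k) k).surjective i
    rw [hrank, hrk]
    split_ifs with h0
    · rw [hNr_def]; omega
    · exact code_bound j' _ (Nat.lt_succ_iff.1 hj')
  -- (8) rank-wise solvability
  have hsolv : ∀ (r : ℕ) (v : Fin (constrCard (Bj M₁ Z k) k) → lieSU (Fin N)), (∀ i, rank i ≠ r → v i = 0) →
      ∃ x : PBond (F.P K) 0 → lieSU (Fin N), (∀ i, rank i = r → L x i = v i) ∧ (∀ i, rank i < r → L x i = 0) ∧ ‖x‖ ≤ β * ‖v‖ := by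
    intro r v hv
    by_cases hex : ∃ (n : ℕ) (_ : n + 1 ≤ k) (y : Site (F.P K) (n + 1)), inner (n + 1) y ∧ code (n + 1) y = r
    · obtain ⟨n, hn, y, hy, hr⟩ := hex
      have hnK : n + 1 ≤ (F.P K).m + (F.P K).K := hn.trans hk
      obtain ⟨hΦQ, hΦsupp⟩ := hΦprops n y hnK
      obtain ⟨u, hu⟩ := hgauge (n + 1) (Nat.succ_pos n) hn y hy
      -- the target on the rows at `y`
      obtain ⟨t, ht_def, htn⟩ : ∃ t : PBond (F.P K) (n + 1) → lieSU (Fin N),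
          (∀ (c : PBond (F.P K) (n + 1)) (hc : c ∈ bondsOf (Bj M₁ Z k (n + 1))), t c = v (constrEnum (Bj M₁ Z k) k ⟨⟨n + 1, Nat.lt_succ_of_le hn⟩, c, hc⟩)) ∧
          ‖t‖ ≤ ‖v‖ := by
        refine ⟨fun c => if h : c ∈ bondsOf (Bj M₁ Z k (n + 1)) then v (constrEnum (Bj M₁ Z k) k ⟨⟨n + 1, Nat.lt_succ_of_le hn⟩, c, h⟩) else 0,
          fun c hc => dif_pos hc, (pi_norm_le_iff_of_nonneg (norm_nonneg v)).2 fun c => ?_⟩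
        dsimp only
        split_ifs with h
        · exact norm_le_pi_norm v _
        · rw [norm_zero]; exact norm_nonneg v
      obtain ⟨X, hXrows, hXsupp, hXn⟩ := hblk (Bj M₁ Z k) h𝔹 hk W U₀ hU hsb hn y (Φf n y) hCΦ0 hΦQ
        (fun w => (hCΦfn n y w).trans (mul_le_mul_of_nonneg_right (hCΦle n (Nat.lt_of_succ_le hn) y) (norm_nonneg _)))
        u hDε0 hDερ₂ hDεC hu t
      have hXsupp' : ∀ b : PBond (F.P K) 0, X b ≠ 0 →
          iterBlockOf (n + 1) b.src = y ∧ iterBlockOf (n + 1) b.tgt = y ∧ iterBlockOf n b.src ≠ iterBlockOf n b.tgt := fun b hb => by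
        obtain ⟨w, hw⟩ := hXsupp b hb
        exact hΦsupp w b hw
      have hinj : ∀ q q' : Site (F.P K) (n + 1), embIter (n + 1) q = embIter (n + 1) q' → q = q' := fun q q' h => by
        rw [← iterBlockOf_embIter (n + 1) hnK q, h, iterBlockOf_embIter (n + 1) hnK q']
      refine ⟨X, fun i hi => ?_, fun i hi => ?_, hXn.trans ?_⟩
      · -- rows of rank `r`: exactly the rows hosted at `y`
        obtain ⟨⟨⟨j', hj'⟩, c', hc'⟩, rfl⟩ := (constrEnum (Bj M₁ Z k) k).surjective i
        rw [hrank, hrk] at hi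
        rw [hLapp]
        split_ifs at hi with h0
        · exact absurd (hi.trans hr.symm) (code_pos _ y).ne
        · have hjn : j' = n + 1 := code_eq j' (n + 1) _ y (Nat.lt_succ_iff.1 hj') hn (hi.trans hr.symm)
          subst hjn
          have hhost : host (n + 1) c' = y := code_inj _ _ _ (hi.trans hr.symm)
          have hcy : c'.src = y ∨ c'.tgt = y := by
            rcases host_mem (n + 1) c' with h | h
            · exact Or.inl (h.symm.trans hhost)
            · exact Or.inr (h.symm.trans hhost)
          rw [hXrows c' hc' hcy, ht_def c' hc']
      · -- rows of smaller rank: level `≤ n`, or level `n+1` not touching `y`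
        obtain ⟨⟨⟨j', hj'⟩, c', hc'⟩, rfl⟩ := (constrEnum (Bj M₁ Z k) k).surjective i
        rw [hrank, hrk] at hi
        rw [hLapp]
        have hfp := fderiv_msChart_apply_eq_zero_of_siteSupport (F := F) hM1 hdiv hk hU hsb hn hy X hXsupp'
          (constrEnum (Bj M₁ Z k) k ⟨⟨j', hj'⟩, c', hc'⟩)
        rw [Equiv.symm_apply_apply] at hfp
        split_ifs at hi with h0
        · refine hfp (Or.inl ?_)
          show j' ≤ n
          omega
        · rw [← hr] at hi
          have hle : j' ≤ n + 1 := code_le_of_lt j' (n + 1) _ y hn hi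
          rcases hle.lt_or_eq with hlt | heq
          · refine hfp (Or.inl ?_)
            show j' ≤ n
            omega
          · subst heq
            have hlt' : φ (n + 1) (host (n + 1) c') < φ (n + 1) y := (code_lt_iff _ _ _).1 hi
            refine hfp (Or.inr ⟨rfl, fun hs => ?_, fun ht => ?_⟩)
            · have hs' : c'.src = y := hinj c'.src y hs
              have := host_max (n + 1) c' y hy (Or.inl hs')
              omega
            · have ht' : c'.tgt = y := hinj c'.tgt y ht
              have := host_max (n + 1) c' y hy (Or.inr ht')
              omega
      · -- the letter
        rw [hβ_def]
        calc 2 * CΦ * ‖t‖ ≤ 2 * CΦ * ‖v‖ := mul_le_mul_of_nonneg_left htn (by linarith)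
          _ ≤ (1 + 2 * CΦ) * ‖v‖ := mul_le_mul_of_nonneg_right (by linarith) (norm_nonneg v)
    · by_cases hr0 : r = 0
      · -- rank 0: the level-0 rows, hit by the identity placement
        subst hr0
        obtain ⟨x, hx_def, hxn⟩ : ∃ x : PBond (F.P K) 0 → lieSU (Fin N),
            (∀ (b : PBond (F.P K) 0) (hb : b ∈ bondsOf (Bj M₁ Z k 0)), x b = v (constrEnum (Bj M₁ Z k) k ⟨⟨0, Nat.succ_pos k⟩, b, hb⟩)) ∧ ‖x‖ ≤ ‖v‖ := by
          refine ⟨fun b => if h : b ∈ bondsOf (Bj M₁ Z k 0) then v (constrEnum (Bj M₁ Z k) k ⟨⟨0, Nat.succ_pos k⟩, b, h⟩) else 0,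
            fun b hb => dif_pos hb, (pi_norm_le_iff_of_nonneg (norm_nonneg v)).2 fun b => ?_⟩
          dsimp only
          split_ifs with h
          · exact norm_le_pi_norm v _
          · rw [norm_zero]; exact norm_nonneg v
        refine ⟨x, fun i hi => ?_, fun i hi => absurd hi (Nat.not_lt_zero _), hxn.trans (le_mul_of_one_le_left (norm_nonneg _) hβ1)⟩
        obtain ⟨⟨⟨j', hj'⟩, c', hc'⟩, rfl⟩ := (constrEnum (Bj M₁ Z k) k).surjective i
        rw [hrank, hrk] at hi
        rw [hLapp]
        split_ifs at hi with h0
        · subst h0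
          rw [fderiv_msChart_apply_levelZero hU hΨ c' hc' x, hx_def c' hc']
        · exact absurd hi (code_pos _ _).ne'
      · -- no row has rank `r`: `x = 0`
        refine ⟨0, fun i hi => ?_, fun i _ => by rw [map_zero]; rfl, by rw [norm_zero]; exact mul_nonneg hβ0 (norm_nonneg _)⟩
        exfalso
        obtain ⟨⟨⟨j', hj'⟩, c', hc'⟩, rfl⟩ := (constrEnum (Bj M₁ Z k) k).surjective i
        rw [hrank, hrk] at hi
        split_ifs at hi with h0
        · exact hr0 hi.symm
        · have hj'k : j' ≤ k := Nat.lt_succ_iff.1 hj'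
          have hpos : 1 ≤ j' := Nat.one_le_iff_ne_zero.2 h0
          obtain ⟨n, rfl⟩ : ∃ n, j' = n + 1 := ⟨j' - 1, by omega⟩
          exact hex ⟨n, hj'k, host (n + 1) c', host_inner _ c' (inner_endpoint_of_mem_bondsOf_Bj hpos hj'k hc'), hi⟩
  -- (9) back-substitution and the norm conversion
  obtain ⟨H, hHinv, hHB⟩ := exists_rightInverse_bound_of_rankwise L rank hNr hβ0 hΛ0 hLbound hsolv
  refine ⟨H, fun v => ?_, fun v => ?_⟩
  · have h := hHinv v
    rwa [hL_def, ContinuousLinearMap.coe_coe] at h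
  · calc Real.sqrt (∑ b, ‖H v b‖ ^ 2) ≤ Real.sqrt (Fintype.card (PBond (F.P K) 0)) * ‖H v‖ := sqrt_sum_sq_le (H v)
      _ ≤ Real.sqrt (Fintype.card (PBond (F.P K) 0)) * (β * Nr * (1 + Λ * β) ^ Nr * ‖v‖) :=
          mul_le_mul_of_nonneg_left (hHB v) (Real.sqrt_nonneg _)
      _ = Real.sqrt (Fintype.card (PBond (F.P K) 0)) * (β * Nr * (1 + Λ * β) ^ Nr) * ‖v‖ := by ring

end Record

end Summit.QuantumFields.YangMills.BalabanUVNodes.N12DirectSurjHsurj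

end
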